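import Summits.CriticalPhenomena.PercolationContinuityZ3.Theorems.PercNearOneGluingNoHeavyLowerTailSahiGridPatternTwoJuntaAll1
import Summits.CriticalPhenomena.PercolationContinuityZ3.Theorems.PercNearOneGluingNoHeavyLowerTailSahiGridPatternTwoJuntaAll2
import Summits.CriticalPhenomena.PercolationContinuityZ3.Theorems.PercNearOneGluingNoHeavyLowerTailSahiGridPatternTwoJuntaAll3
import Summits.CriticalPhenomena.PercolationContinuityZ3.Theorems.PercNearOneGluingNoHeavyLowerTailSahiGridPatternTwoJuntaAll4

/-!
# `NoHeavyLowerTail` (crux stmt-CriticalPhenomena-4575), Sahi programme: **EVERY TWO-COORDINATE SLOT IS GOOD, IN EVERY DIMENSION —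
# one theorem** (assembly of the two-junta table `…SahiGridPatternTwoJunta{,All1–4}` with the axis symmetries)

Support file (seat `prim-sahi-p1`, generation 10; `--supports stmt-CriticalPhenomena-4575`).  Pure proofs, no definitions, no `sorry`,
standard axioms.  Vocabulary of `…SahiGridPattern{,AllDim,Faces}` (`Pd`, `sStarD`, `PatternPos`, `compEquivD`, `slicePos_perm`).

THE MATHEMATICS.  `P_d = [3]^d`, `sStarD A B C` the pattern functional (the three-copy Sahi kernel summed over the `6^d` Latin
triples), `PatternPos d :⟺ sStarD ≥ 0` on up-set triples (⟹ Sahi's `C₃` / Kahn's Conjecture 5 coefficientwise, `…SahiGridPattern`).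
Say that `A ⊆ P_d` DEPENDS ONLY ON THE COORDINATES `i ≠ j` if membership of `x` in `A` is decided by `(x_i, x_j)`.

* `upTable_cases`: a predicate on `[3] × [3]` that is monotone in both arguments is one of the `20` up-sets of `[3]²` (listed by cells;
  proof: row thresholds `t₀ ≥ t₁ ≥ t₂` and `interval_cases`).
* `sStarD_nonneg_lastTwo`: if membership of `snoc (snoc q l) i` in `S ⊆ P_{n+2}` is a monotone predicate of `(l, i)` alone, then
  `0 ≤ sStarD S B C` for all up-sets `B, C` — the twelve explicit theorems `sStarD_nonneg_twoJunta_81/_157`, `sStarD_nonneg_twoJuntaU_…`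
  (one per up-set of `[3]²` modulo the axis swap, generation 9, exact two-set certificates), the six transposed tables by the swap of the
  last two axes (`slicePos_perm`), and the two trivial tables.
* **`sStarD_nonneg_of_twoCoord`** (every `d`): if the up-set `A ⊆ P_d` depends only on two coordinates `i ≠ j`, then `0 ≤ sStarD A B C` for
  ALL up-sets `B, C ⊆ P_d`; slot-permuted forms `sStarD_nonneg_of_twoCoord₂/₃`.  (A permutation of the axes moving `i, j` to the last two
  positions reduces to `sStarD_nonneg_lastTwo`.)  In particular every up-set depending on at most two coordinates (a '2-junta': `x_i ≥ 2 ∨ x_j ≥ 1`,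
  `x_i + x_j ≥ 3`, …) is a good slot of the pattern inequality in every dimension, the other two slots being ARBITRARY up-sets — the
  statement recorded in generation 9 as 'assembled from twelve theorems', now a single declaration.  The grid / product-measure form (Sahi's
  `E₃(1_A,1_B,1_C) ≥ 0` on every grid `[K+1]^d` when the increasing event `A` depends on two coordinates) is in the companion file
  `…SahiGridPatternTwoCoordGrid`.
HONEST LABEL: three or more coordinates (`USD(k)`, `k ≥ 3`) are certificate-grade only (junta-3: 224/224 exact identities, two engines); `PatternPos d`
for `d ≥ 4` as a whole, Sahi's `C₃` and Kahn's conjecture remain OPEN; nothing here asserts them. [this work]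
-/

namespace Summit.CriticalPhenomena.PercolationContinuityZ3.Theorems.SahiGridPattern

open Finset SahiGrid3
open scoped BigOperators

variable {n : ℕ}

/-! ### The twenty up-sets of `[3]²` -/

/-- A monotone predicate on `[3]` is an upper interval `{i : t ≤ i}`, `t ∈ {0,1,2,3}`. [this work] -/
theorem upRow_threshold (R : Fin 3 → Prop) (hR : ∀ i i' : Fin 3, i ≤ i' → R i → R i') :
    ∃ t : ℕ, t ≤ 3 ∧ ∀ i : Fin 3, R i ↔ t ≤ (i : ℕ) := by
  by_cases h0 : R 0
  · exact ⟨0, by norm_num, fun i => iff_of_true (hR 0 i (Fin.zero_le _) h0) (Nat.zero_le _)⟩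
  by_cases h1 : R 1
  · refine ⟨1, by norm_num, fun i => ?_⟩
    match i with
    | ⟨0, _⟩ => exact iff_of_false h0 (by norm_num)
    | ⟨1, _⟩ => exact iff_of_true h1 (by norm_num)
    | ⟨2, _⟩ => exact iff_of_true (hR 1 2 (by decide) h1) (by norm_num)
  by_cases h2 : R 2
  · refine ⟨2, by norm_num, fun i => ?_⟩
    match i with
    | ⟨0, _⟩ => exact iff_of_false h0 (by norm_num)
    | ⟨1, _⟩ => exact iff_of_false h1 (by norm_num)
    | ⟨2, _⟩ => exact iff_of_true h2 (by norm_num)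
  · refine ⟨3, le_rfl, fun i => ?_⟩
    match i with
    | ⟨0, _⟩ => exact iff_of_false h0 (by norm_num)
    | ⟨1, _⟩ => exact iff_of_false h1 (by norm_num)
    | ⟨2, _⟩ => exact iff_of_false h2 (by norm_num)

/-- **The twenty up-sets of `[3]²`**: a predicate on `[3] × [3]` monotone in both arguments is given by one of twenty explicit cell lists
(ordered by the row thresholds `t₀ ≥ t₁ ≥ t₂`). [this work] -/
theorem upTable_cases (P : Fin 3 → Fin 3 → Prop) (hmono : ∀ l l' i i' : Fin 3, l ≤ l' → i ≤ i' → P l i → P l' i') :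
    (∀ l i : Fin 3, P l i ↔ True) ∨
    (∀ l i : Fin 3, P l i ↔ ((l = 0 ∧ i = 1) ∨ (l = 0 ∧ i = 2) ∨ (l = 1 ∧ i = 0) ∨ (l = 1 ∧ i = 1) ∨ (l = 1 ∧ i = 2) ∨ (l = 2 ∧ i = 0) ∨ (l = 2 ∧ i = 1) ∨ (l = 2 ∧ i = 2))) ∨
    (∀ l i : Fin 3, P l i ↔ ((l = 0 ∧ i = 1) ∨ (l = 0 ∧ i = 2) ∨ (l = 1 ∧ i = 1) ∨ (l = 1 ∧ i = 2) ∨ (l = 2 ∧ i = 0) ∨ (l = 2 ∧ i = 1) ∨ (l = 2 ∧ i = 2))) ∨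
    (∀ l i : Fin 3, P l i ↔ ((l = 0 ∧ i = 1) ∨ (l = 0 ∧ i = 2) ∨ (l = 1 ∧ i = 1) ∨ (l = 1 ∧ i = 2) ∨ (l = 2 ∧ i = 1) ∨ (l = 2 ∧ i = 2))) ∨
    (∀ l i : Fin 3, P l i ↔ ((l = 0 ∧ i = 2) ∨ (l = 1 ∧ i = 0) ∨ (l = 1 ∧ i = 1) ∨ (l = 1 ∧ i = 2) ∨ (l = 2 ∧ i = 0) ∨ (l = 2 ∧ i = 1) ∨ (l = 2 ∧ i = 2))) ∨
    (∀ l i : Fin 3, P l i ↔ ((l = 0 ∧ i = 2) ∨ (l = 1 ∧ i = 1) ∨ (l = 1 ∧ i = 2) ∨ (l = 2 ∧ i = 0) ∨ (l = 2 ∧ i = 1) ∨ (l = 2 ∧ i = 2))) ∨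
    (∀ l i : Fin 3, P l i ↔ ((l = 0 ∧ i = 2) ∨ (l = 1 ∧ i = 1) ∨ (l = 1 ∧ i = 2) ∨ (l = 2 ∧ i = 1) ∨ (l = 2 ∧ i = 2))) ∨
    (∀ l i : Fin 3, P l i ↔ ((l = 0 ∧ i = 2) ∨ (l = 1 ∧ i = 2) ∨ (l = 2 ∧ i = 0) ∨ (l = 2 ∧ i = 1) ∨ (l = 2 ∧ i = 2))) ∨
    (∀ l i : Fin 3, P l i ↔ ((l = 0 ∧ i = 2) ∨ (l = 1 ∧ i = 2) ∨ (l = 2 ∧ i = 1) ∨ (l = 2 ∧ i = 2))) ∨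
    (∀ l i : Fin 3, P l i ↔ ((l = 0 ∧ i = 2) ∨ (l = 1 ∧ i = 2) ∨ (l = 2 ∧ i = 2))) ∨
    (∀ l i : Fin 3, P l i ↔ ((l = 1 ∧ i = 0) ∨ (l = 1 ∧ i = 1) ∨ (l = 1 ∧ i = 2) ∨ (l = 2 ∧ i = 0) ∨ (l = 2 ∧ i = 1) ∨ (l = 2 ∧ i = 2))) ∨
    (∀ l i : Fin 3, P l i ↔ ((l = 1 ∧ i = 1) ∨ (l = 1 ∧ i = 2) ∨ (l = 2 ∧ i = 0) ∨ (l = 2 ∧ i = 1) ∨ (l = 2 ∧ i = 2))) ∨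
    (∀ l i : Fin 3, P l i ↔ ((l = 1 ∧ i = 1) ∨ (l = 1 ∧ i = 2) ∨ (l = 2 ∧ i = 1) ∨ (l = 2 ∧ i = 2))) ∨
    (∀ l i : Fin 3, P l i ↔ ((l = 1 ∧ i = 2) ∨ (l = 2 ∧ i = 0) ∨ (l = 2 ∧ i = 1) ∨ (l = 2 ∧ i = 2))) ∨
    (∀ l i : Fin 3, P l i ↔ ((l = 1 ∧ i = 2) ∨ (l = 2 ∧ i = 1) ∨ (l = 2 ∧ i = 2))) ∨
    (∀ l i : Fin 3, P l i ↔ ((l = 1 ∧ i = 2) ∨ (l = 2 ∧ i = 2))) ∨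
    (∀ l i : Fin 3, P l i ↔ ((l = 2 ∧ i = 0) ∨ (l = 2 ∧ i = 1) ∨ (l = 2 ∧ i = 2))) ∨
    (∀ l i : Fin 3, P l i ↔ ((l = 2 ∧ i = 1) ∨ (l = 2 ∧ i = 2))) ∨
    (∀ l i : Fin 3, P l i ↔ ((l = 2 ∧ i = 2))) ∨
    (∀ l i : Fin 3, P l i ↔ False) := by
  obtain ⟨t0, ht0, r0⟩ := upRow_threshold (P 0) fun i i' h => hmono 0 0 i i' le_rfl h
  obtain ⟨t1, ht1, r1⟩ := upRow_threshold (P 1) fun i i' h => hmono 1 1 i i' le_rfl h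
  obtain ⟨t2, ht2, r2⟩ := upRow_threshold (P 2) fun i i' h => hmono 2 2 i i' le_rfl h
  -- column monotonicity: the thresholds do not increase
  have h10 : t1 ≤ t0 := by
    by_contra h
    have ht0' : t0 ≤ 2 := by omega
    have := (r1 ⟨t0, by omega⟩).1 (hmono 0 1 ⟨t0, by omega⟩ ⟨t0, by omega⟩ (by decide) le_rfl ((r0 ⟨t0, by omega⟩).2 le_rfl))
    exact h this
  have h21 : t2 ≤ t1 := by
    by_contra h
    have ht1' : t1 ≤ 2 := by omega
    have := (r2 ⟨t1, by omega⟩).1 (hmono 1 2 ⟨t1, by omega⟩ ⟨t1, by omega⟩ (by decide) le_rfl ((r1 ⟨t1, by omega⟩).2 le_rfl))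
    exact h this
  have rows : ∀ l i : Fin 3, P l i ↔ (![t0, t1, t2] : Fin 3 → ℕ) l ≤ (i : ℕ) := by
    intro l i
    match l with
    | ⟨0, _⟩ => exact r0 i
    | ⟨1, _⟩ => exact r1 i
    | ⟨2, _⟩ => exact r2 i
  clear r0 r1 r2
  interval_cases t0 <;> interval_cases t1 <;> interval_cases t2
  · refine Or.inl ?_
    intro l i; rw [rows l i]; revert l i; decide
  · refine Or.inr (Or.inl ?_)
    intro l i; rw [rows l i]; revert l i; decide
  · refine Or.inr (Or.inr (Or.inl ?_))
    intro l i; rw [rows l i]; revert l i; decide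
  · refine Or.inr (Or.inr (Or.inr (Or.inl ?_)))
    intro l i; rw [rows l i]; revert l i; decide
  · refine Or.inr (Or.inr (Or.inr (Or.inr (Or.inl ?_))))
    intro l i; rw [rows l i]; revert l i; decide
  · refine Or.inr (Or.inr (Or.inr (Or.inr (Or.inr (Or.inl ?_)))))
    intro l i; rw [rows l i]; revert l i; decide
  · refine Or.inr (Or.inr (Or.inr (Or.inr (Or.inr (Or.inr (Or.inl ?_))))))
    intro l i; rw [rows l i]; revert l i; decide
  · refine Or.inr (Or.inr (Or.inr (Or.inr (Or.inr (Or.inr (Or.inr (Or.inl ?_)))))))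
    intro l i; rw [rows l i]; revert l i; decide
  · refine Or.inr (Or.inr (Or.inr (Or.inr (Or.inr (Or.inr (Or.inr (Or.inr (Or.inl ?_))))))))
    intro l i; rw [rows l i]; revert l i; decide
  · refine Or.inr (Or.inr (Or.inr (Or.inr (Or.inr (Or.inr (Or.inr (Or.inr (Or.inr (Or.inl ?_)))))))))
    intro l i; rw [rows l i]; revert l i; decide
  · refine Or.inr (Or.inr (Or.inr (Or.inr (Or.inr (Or.inr (Or.inr (Or.inr (Or.inr (Or.inr (Or.inl ?_))))))))))
    intro l i; rw [rows l i]; revert l i; decide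
  · refine Or.inr (Or.inr (Or.inr (Or.inr (Or.inr (Or.inr (Or.inr (Or.inr (Or.inr (Or.inr (Or.inr (Or.inl ?_)))))))))))
    intro l i; rw [rows l i]; revert l i; decide
  · refine Or.inr (Or.inr (Or.inr (Or.inr (Or.inr (Or.inr (Or.inr (Or.inr (Or.inr (Or.inr (Or.inr (Or.inr (Or.inl ?_))))))))))))
    intro l i; rw [rows l i]; revert l i; decide
  · refine Or.inr (Or.inr (Or.inr (Or.inr (Or.inr (Or.inr (Or.inr (Or.inr (Or.inr (Or.inr (Or.inr (Or.inr (Or.inr (Or.inl ?_)))))))))))))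
    intro l i; rw [rows l i]; revert l i; decide
  · refine Or.inr (Or.inr (Or.inr (Or.inr (Or.inr (Or.inr (Or.inr (Or.inr (Or.inr (Or.inr (Or.inr (Or.inr (Or.inr (Or.inr (Or.inl ?_))))))))))))))
    intro l i; rw [rows l i]; revert l i; decide
  · refine Or.inr (Or.inr (Or.inr (Or.inr (Or.inr (Or.inr (Or.inr (Or.inr (Or.inr (Or.inr (Or.inr (Or.inr (Or.inr (Or.inr (Or.inr (Or.inl ?_)))))))))))))))
    intro l i; rw [rows l i]; revert l i; decide
  · refine Or.inr (Or.inr (Or.inr (Or.inr (Or.inr (Or.inr (Or.inr (Or.inr (Or.inr (Or.inr (Or.inr (Or.inr (Or.inr (Or.inr (Or.inr (Or.inr (Or.inl ?_))))))))))))))))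
    intro l i; rw [rows l i]; revert l i; decide
  · refine Or.inr (Or.inr (Or.inr (Or.inr (Or.inr (Or.inr (Or.inr (Or.inr (Or.inr (Or.inr (Or.inr (Or.inr (Or.inr (Or.inr (Or.inr (Or.inr (Or.inr (Or.inl ?_)))))))))))))))))
    intro l i; rw [rows l i]; revert l i; decide
  · refine Or.inr (Or.inr (Or.inr (Or.inr (Or.inr (Or.inr (Or.inr (Or.inr (Or.inr (Or.inr (Or.inr (Or.inr (Or.inr (Or.inr (Or.inr (Or.inr (Or.inr (Or.inr (Or.inl ?_))))))))))))))))))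
    intro l i; rw [rows l i]; revert l i; decide
  · refine Or.inr (Or.inr (Or.inr (Or.inr (Or.inr (Or.inr (Or.inr (Or.inr (Or.inr (Or.inr (Or.inr (Or.inr (Or.inr (Or.inr (Or.inr (Or.inr (Or.inr (Or.inr (Or.inr ?_))))))))))))))))))
    intro l i; rw [rows l i]; revert l i; decide

/-! ### Points of `[3]^{n+2}` through their last two coordinates -/

/-- Every point of `[3]^{n+2}` is `snoc (snoc q l) i`. [this work] -/
theorem exists_eq_snoc_snoc (x : Pd (n + 2)) :
    ∃ (q : Pd n) (l i : Fin 3), x = Fin.snoc (Fin.snoc q l : Pd (n + 1)) i :=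
  ⟨Fin.init (Fin.init x), Fin.init x (Fin.last n), x (Fin.last (n + 1)), by
    conv_lhs => rw [← Fin.snoc_init_self x, ← Fin.snoc_init_self (Fin.init x)]⟩

/-- `snoc (snoc q l) i` is monotone in `(l, i)`. [this work] -/
theorem snoc_snoc_le_snoc_snoc (q : Pd n) {l l' i i' : Fin 3} (hl : l ≤ l') (hi : i ≤ i') :
    (Fin.snoc (Fin.snoc q l : Pd (n + 1)) i : Pd (n + 2)) ≤ Fin.snoc (Fin.snoc q l' : Pd (n + 1)) i' :=
  le_trans (snoc_le_snoc_of_le_left (snoc_le_snoc_of_le q hl) i) (snoc_le_snoc_of_le _ hi)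

/-- The swap of the last two axes exchanges the last two coordinates of `snoc (snoc q l) i`. [this work] -/
theorem snoc_snoc_comp_swap (q : Pd n) (l i : Fin 3) :
    (Fin.snoc (Fin.snoc q l : Pd (n + 1)) i : Pd (n + 2)) ∘ (Equiv.swap (Fin.castSucc (Fin.last n)) (Fin.last (n + 1))) =
      Fin.snoc (Fin.snoc q i : Pd (n + 1)) l := by
  funext a
  simp only [Function.comp_apply]
  by_cases ha : a = Fin.castSucc (Fin.last n)
  · subst ha
    rw [Equiv.swap_apply_left, Fin.snoc_last, Fin.snoc_castSucc, Fin.snoc_last]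
  by_cases hb : a = Fin.last (n + 1)
  · subst hb
    rw [Equiv.swap_apply_right, Fin.snoc_last, Fin.snoc_castSucc, Fin.snoc_last]
  · rw [Equiv.swap_apply_of_ne_of_ne ha hb]
    obtain ⟨a', rfl⟩ := Fin.eq_castSucc_of_ne_last hb
    have ha' : a' ≠ Fin.last n := fun h => ha (by rw [h])
    obtain ⟨a'', rfl⟩ := Fin.eq_castSucc_of_ne_last ha'
    simp only [Fin.snoc_castSucc]

/-- **Transposed tables**: if membership of `snoc (snoc q l) i` in `S` is `P l i`, then the image of `S` under the swap of the last two axes has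
table `P i l`; so goodness for the transposed table gives goodness for `S` (`slicePos_perm`). [this work] -/
theorem sStarD_nonneg_of_transposedTable {S : Finset (Pd (n + 2))} {P : Fin 3 → Fin 3 → Prop}
    (hS : ∀ (q : Pd n) (l i : Fin 3), (Fin.snoc (Fin.snoc q l : Pd (n + 1)) i : Pd (n + 2)) ∈ S ↔ P l i)
    (hT : ∀ A : Finset (Pd (n + 2)), (∀ (q : Pd n) (l i : Fin 3), (Fin.snoc (Fin.snoc q l : Pd (n + 1)) i : Pd (n + 2)) ∈ A ↔ P i l) →
      ∀ B C : Finset (Pd (n + 2)), IsUpperSet (B : Set (Pd (n + 2))) → IsUpperSet (C : Set (Pd (n + 2))) → 0 ≤ sStarD A B C)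
    (B C : Finset (Pd (n + 2))) (hB : IsUpperSet (B : Set (Pd (n + 2)))) (hC : IsUpperSet (C : Set (Pd (n + 2)))) :
    0 ≤ sStarD S B C := by
  set τ : Equiv.Perm (Fin (n + 2)) := Equiv.swap (Fin.castSucc (Fin.last n)) (Fin.last (n + 1)) with hτ
  set A : Finset (Pd (n + 2)) := S.map (compEquivD τ).toEmbedding with hAdef
  have hτsymm : τ.symm = τ := Equiv.symm_swap _ _
  have memA : ∀ p : Pd (n + 2), p ∈ A ↔ p ∘ τ ∈ S := by
    intro p; rw [hAdef, Finset.mem_map_equiv]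
    show p ∘ τ.symm ∈ S ↔ _
    rw [hτsymm]
  have hA : ∀ (q : Pd n) (l i : Fin 3), (Fin.snoc (Fin.snoc q l : Pd (n + 1)) i : Pd (n + 2)) ∈ A ↔ P i l := by
    intro q l i; rw [memA, hτ, snoc_snoc_comp_swap, hS]
  have h : ∀ p : Pd (n + 2), p ∈ S ↔ p ∘ τ ∈ A := by
    intro p; rw [memA]
    have e : (p ∘ τ) ∘ τ = p := by funext a; simp [hτ, Equiv.swap_apply_self]
    rw [e]
  have step : ∀ B' C' : Finset (Pd (n + 2)), IsUpperSet (B' : Set (Pd (n + 2))) → IsUpperSet (C' : Set (Pd (n + 2))) →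
      0 ≤ ∑ x ∈ A, ∑ y ∈ B', ∑ z ∈ C', tcD x y z := by
    intro B' C' hB' hC'; rw [← sStarD_eq_sum_tcD]; exact hT A hA B' C' hB' hC'
  rw [sStarD_eq_sum_tcD]
  exact slicePos_perm τ step h B C hB hC

/-! ### A monotone table on the last two coordinates: all twenty cases -/

/-- **Every up-set of `[3]^{n+2}` decided by its last two coordinates is a good first slot** (every `n`): if membership of
`snoc (snoc q l) i` in `S` is a predicate `P l i` monotone in `(l, i)`, then `0 ≤ sStarD S B C` for all up-sets `B, C`. [this work] -/
theorem sStarD_nonneg_lastTwo (S : Finset (Pd (n + 2))) {P : Fin 3 → Fin 3 → Prop}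
    (hS : ∀ (q : Pd n) (l i : Fin 3), (Fin.snoc (Fin.snoc q l : Pd (n + 1)) i : Pd (n + 2)) ∈ S ↔ P l i)
    (hmono : ∀ l l' i i' : Fin 3, l ≤ l' → i ≤ i' → P l i → P l' i')
    (B C : Finset (Pd (n + 2))) (hB : IsUpperSet (B : Set (Pd (n + 2)))) (hC : IsUpperSet (C : Set (Pd (n + 2)))) :
    0 ≤ sStarD S B C := by
  rcases upTable_cases P hmono with hP | hP | hP | hP | hP | hP | hP | hP | hP | hP | hP | hP | hP | hP | hP | hP | hP | hP | hP | hP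
  · -- the full table: `S = univ`
    have e : S = univ := by
      ext x; simp only [Finset.mem_univ, iff_true]
      obtain ⟨q, l, i, rfl⟩ := exists_eq_snoc_snoc x
      exact (hS q l i).2 ((hP l i).2 trivial)
    rw [e]; exact sStarD_nonneg_of_eq_univ₁ hB hC
  · exact sStarD_nonneg_twoJuntaU_0102101112202122 S B C hB hC fun q l i => (hS q l i).trans (hP l i)
  · exact sStarD_nonneg_twoJuntaU_01021112202122 S B C hB hC fun q l i => (hS q l i).trans (hP l i)
  · exact sStarD_nonneg_twoJuntaU_010211122122 S B C hB hC fun q l i => (hS q l i).trans (hP l i)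
  · refine sStarD_nonneg_of_transposedTable hS (fun A hA B' C' hB' hC' => ?_) B C hB hC
    refine sStarD_nonneg_twoJuntaU_01021112202122 A B' C' hB' hC' fun q l i => (hA q l i).trans ((hP i l).trans ?_)
    revert l i; decide
  · exact sStarD_nonneg_twoJunta_157 S B C hB hC fun q l i => (hS q l i).trans (hP l i)
  · exact sStarD_nonneg_twoJuntaU_0211122122 S B C hB hC fun q l i => (hS q l i).trans (hP l i)
  · exact sStarD_nonneg_twoJuntaU_0212202122 S B C hB hC fun q l i => (hS q l i).trans (hP l i)
  · exact sStarD_nonneg_twoJuntaU_02122122 S B C hB hC fun q l i => (hS q l i).trans (hP l i)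
  · exact sStarD_nonneg_twoJuntaU_021222 S B C hB hC fun q l i => (hS q l i).trans (hP l i)
  · refine sStarD_nonneg_of_transposedTable hS (fun A hA B' C' hB' hC' => ?_) B C hB hC
    refine sStarD_nonneg_twoJuntaU_010211122122 A B' C' hB' hC' fun q l i => (hA q l i).trans ((hP i l).trans ?_)
    revert l i; decide
  · refine sStarD_nonneg_of_transposedTable hS (fun A hA B' C' hB' hC' => ?_) B C hB hC
    refine sStarD_nonneg_twoJuntaU_0211122122 A B' C' hB' hC' fun q l i => (hA q l i).trans ((hP i l).trans ?_)
    revert l i; decide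
  · exact sStarD_nonneg_twoJuntaU_11122122 S B C hB hC fun q l i => (hS q l i).trans (hP l i)
  · refine sStarD_nonneg_of_transposedTable hS (fun A hA B' C' hB' hC' => ?_) B C hB hC
    refine sStarD_nonneg_twoJuntaU_02122122 A B' C' hB' hC' fun q l i => (hA q l i).trans ((hP i l).trans ?_)
    revert l i; decide
  · exact sStarD_nonneg_twoJunta_81 S B C hB hC fun q l i => (hS q l i).trans (hP l i)
  · exact sStarD_nonneg_twoJuntaU_1222 S B C hB hC fun q l i => (hS q l i).trans (hP l i)
  · refine sStarD_nonneg_of_transposedTable hS (fun A hA B' C' hB' hC' => ?_) B C hB hC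
    refine sStarD_nonneg_twoJuntaU_021222 A B' C' hB' hC' fun q l i => (hA q l i).trans ((hP i l).trans ?_)
    revert l i; decide
  · refine sStarD_nonneg_of_transposedTable hS (fun A hA B' C' hB' hC' => ?_) B C hB hC
    refine sStarD_nonneg_twoJuntaU_1222 A B' C' hB' hC' fun q l i => (hA q l i).trans ((hP i l).trans ?_)
    revert l i; decide
  · exact sStarD_nonneg_twoJuntaU_22 S B C hB hC fun q l i => (hS q l i).trans (hP l i)
  · -- the empty table: `S = ∅`
    have e : S = ∅ := by
      ext x; simp only [Finset.notMem_empty, iff_false]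
      obtain ⟨q, l, i, rfl⟩ := exists_eq_snoc_snoc x
      exact fun h => (hP l i).1 ((hS q l i).1 h)
    rw [e, sStarD_empty_left]

/-! ### Every two-coordinate slot, every dimension -/

/-- **THE PATTERN INEQUALITY WITH ONE TWO-COORDINATE SLOT, EVERY DIMENSION.**  If the up-set `A ⊆ [3]^d` depends only on the coordinates
`i ≠ j` (membership of `x` is decided by `(x_i, x_j)`), then `0 ≤ sStarD A B C` for ALL up-sets `B, C ⊆ [3]^d`. [this work] -/
theorem sStarD_nonneg_of_twoCoord {d : ℕ} (i j : Fin d) (hij : i ≠ j) {A : Finset (Pd d)} (hA : IsUpperSet (A : Set (Pd d)))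
    (hdep : ∀ x y : Pd d, x i = y i → x j = y j → (x ∈ A ↔ y ∈ A))
    (B C : Finset (Pd d)) (hB : IsUpperSet (B : Set (Pd d))) (hC : IsUpperSet (C : Set (Pd d))) :
    0 ≤ sStarD A B C := by
  -- `d ≥ 2`
  obtain ⟨n, rfl⟩ : ∃ n, d = n + 2 := by
    have h2 : 2 ≤ d := by
      rcases Nat.lt_or_ge d 2 with h | h
      · exfalso
        have : Subsingleton (Fin d) := by
          rcases Nat.lt_succ_iff.1 h |>.eq_or_lt with h1 | h0
          · subst h1; infer_instance
          · have h0' : d = 0 := by omega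
            subst h0'; infer_instance
        exact hij (Subsingleton.elim i j)
      · exact h
    exact ⟨d - 2, by omega⟩
  -- an axis permutation `ρ` with `ρ i = n` (second-to-last axis) and `ρ j = n+1` (last axis)
  set a : Fin (n + 2) := Fin.castSucc (Fin.last n) with ha
  set b : Fin (n + 2) := Fin.last (n + 1) with hb
  have hab : a ≠ b := by
    rw [ha, hb]; exact (Fin.castSucc_lt_last (Fin.last n)).ne
  set j1 : Fin (n + 2) := Equiv.swap i a j with hj1
  have hj1a : j1 ≠ a := by
    intro h
    rw [hj1] at h
    have : j = i := by
      have := congrArg (Equiv.swap i a) h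
      rwa [Equiv.swap_apply_self, Equiv.swap_apply_right] at this
    exact hij this.symm
  set ρ : Equiv.Perm (Fin (n + 2)) := (Equiv.swap i a).trans (Equiv.swap j1 b) with hρ
  have hρi : ρ i = a := by
    rw [hρ, Equiv.trans_apply, Equiv.swap_apply_left, Equiv.swap_apply_of_ne_of_ne hj1a.symm hab]
  have hρj : ρ j = b := by
    rw [hρ, Equiv.trans_apply]
    show Equiv.swap j1 b (Equiv.swap i a j) = b
    rw [← hj1, Equiv.swap_apply_left]
  -- the permuted set `S = {s : s ∘ ρ ∈ A}` is decided by its last two coordinates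
  set τ : Equiv.Perm (Fin (n + 2)) := ρ.symm with hτ
  set S : Finset (Pd (n + 2)) := A.map (compEquivD τ).toEmbedding with hSdef
  have memS : ∀ s : Pd (n + 2), s ∈ S ↔ s ∘ ρ ∈ A := by
    intro s; rw [hSdef, Finset.mem_map_equiv]
    show s ∘ τ.symm ∈ A ↔ _
    rw [hτ, Equiv.symm_symm]
  set z : Pd n := fun _ => 0 with hz
  set P : Fin 3 → Fin 3 → Prop := fun l i' => (Fin.snoc (Fin.snoc z l : Pd (n + 1)) i' : Pd (n + 2)) ∘ ρ ∈ A with hPdef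
  have val_i : ∀ (q : Pd n) (l i' : Fin 3), ((Fin.snoc (Fin.snoc q l : Pd (n + 1)) i' : Pd (n + 2)) ∘ ρ) i = l := by
    intro q l i'
    rw [Function.comp_apply, hρi, ha, Fin.snoc_castSucc, Fin.snoc_last]
  have val_j : ∀ (q : Pd n) (l i' : Fin 3), ((Fin.snoc (Fin.snoc q l : Pd (n + 1)) i' : Pd (n + 2)) ∘ ρ) j = i' := by
    intro q l i'
    rw [Function.comp_apply, hρj, hb, Fin.snoc_last]
  have hS : ∀ (q : Pd n) (l i' : Fin 3), (Fin.snoc (Fin.snoc q l : Pd (n + 1)) i' : Pd (n + 2)) ∈ S ↔ P l i' := by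
    intro q l i'
    rw [memS, hPdef]
    exact hdep _ _ (by rw [val_i, val_i]) (by rw [val_j, val_j])
  have hmono : ∀ l l' i' i'' : Fin 3, l ≤ l' → i' ≤ i'' → P l i' → P l' i'' := by
    intro l l' i' i'' hl hi h
    rw [hPdef] at h ⊢
    refine hA (fun c => ?_) h
    exact snoc_snoc_le_snoc_snoc z hl hi (ρ c)
  -- goodness of `S`, transported back along `ρ`
  have good := sStarD_nonneg_lastTwo S hS hmono
  have h : ∀ p : Pd (n + 2), p ∈ A ↔ p ∘ τ ∈ S := by
    intro p; rw [memS]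
    have e : (p ∘ τ) ∘ ρ = p := by funext c; simp [hτ]
    rw [e]
  have step : ∀ B' C' : Finset (Pd (n + 2)), IsUpperSet (B' : Set (Pd (n + 2))) → IsUpperSet (C' : Set (Pd (n + 2))) →
      0 ≤ ∑ x ∈ S, ∑ y ∈ B', ∑ w ∈ C', tcD x y w := by
    intro B' C' hB' hC'; rw [← sStarD_eq_sum_tcD]; exact good B' C' hB' hC'
  rw [sStarD_eq_sum_tcD]
  exact slicePos_perm τ step h B C hB hC

/-- Two-coordinate slot in the second position. [this work] -/
theorem sStarD_nonneg_of_twoCoord₂ {d : ℕ} (i j : Fin d) (hij : i ≠ j) {A B C : Finset (Pd d)}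
    (hB : IsUpperSet (B : Set (Pd d))) (hdep : ∀ x y : Pd d, x i = y i → x j = y j → (x ∈ B ↔ y ∈ B))
    (hA : IsUpperSet (A : Set (Pd d))) (hC : IsUpperSet (C : Set (Pd d))) : 0 ≤ sStarD A B C := by
  rw [sStarD_swap12]; exact sStarD_nonneg_of_twoCoord i j hij hB hdep A C hA hC

/-- Two-coordinate slot in the third position. [this work] -/
theorem sStarD_nonneg_of_twoCoord₃ {d : ℕ} (i j : Fin d) (hij : i ≠ j) {A B C : Finset (Pd d)}
    (hC : IsUpperSet (C : Set (Pd d))) (hdep : ∀ x y : Pd d, x i = y i → x j = y j → (x ∈ C ↔ y ∈ C))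
    (hA : IsUpperSet (A : Set (Pd d))) (hB : IsUpperSet (B : Set (Pd d))) : 0 ≤ sStarD A B C := by
  rw [sStarD_swap23, sStarD_swap12]; exact sStarD_nonneg_of_twoCoord i j hij hC hdep A B hA hB

/-- **One-coordinate slots** (every `d ≥ 2`… and trivially `d = 1` via `PatternPos 1`): an up-set depending on a single coordinate `i` is
a two-coordinate set for any second index; recorded for `d = n + 2` with the other index chosen automatically. [this work] -/
theorem sStarD_nonneg_of_oneCoord (i : Fin (n + 2)) {A : Finset (Pd (n + 2))} (hA : IsUpperSet (A : Set (Pd (n + 2))))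
    (hdep : ∀ x y : Pd (n + 2), x i = y i → (x ∈ A ↔ y ∈ A))
    (B C : Finset (Pd (n + 2))) (hB : IsUpperSet (B : Set (Pd (n + 2)))) (hC : IsUpperSet (C : Set (Pd (n + 2)))) :
    0 ≤ sStarD A B C := by
  by_cases hi : i = 0
  · exact sStarD_nonneg_of_twoCoord i 1 (by rw [hi]; exact Fin.zero_ne_one) hA (fun x y h _ => hdep x y h) B C hB hC
  · exact sStarD_nonneg_of_twoCoord i 0 hi hA (fun x y h _ => hdep x y h) B C hB hC

end Summit.CriticalPhenomena.PercolationContinuityZ3.Theorems.SahiGridPattern
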